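import Mathlib
import HarnessLib
import Literature.AlgebraicGeometry.Crystalline.BlochEsnaultKerzLifting
import Literature.AlgebraicGeometry.Motives.HodgeSheaves

/-!
# Sketch — first lemmas of the crux ideas for `FormalLiftingFromClassLifting`
(stmt-HodgeConjecture-13825, route PadicSemiregularLift, crux P1a), ideator 2, round 1.

Statements only: every `def … : Prop` below must ELABORATE over the tree's real vocabulary
(`WittScheme.thickening/thickeningMap/specialFibreToThickening/LiftsFormally`, `KTheory.KZero`,
`KTheory.ContinuousKZeroRat`, `Motives.structureSheafCohomology`, `Motives.hodgeCohomologyOne`,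
`Motives.cotangentSheaf`). Nothing here is proved; nothing here is a route item.

* `ClassLiftsImplyObjectLifts`  — hypothesis (⋆) of the crux, verbatim, as a named predicate.
* `IsProClass`, `IntegralProLift` (= (Lift_int)), `KernelClassesExtend` (= (Surj)).
* Card A `pro-class-correction-syntomic`: `TransferA` (pure bookkeeping:
  (⋆) ∧ (Lift_int) ∧ (Surj) ⇒ LiftsFormally) and `IntegralProLiftOfRational` ((Lift_int) from the
  crux's rational Bloch–Esnault–Kerz hypothesis under torsion-free Hodge cohomology).
* Card B `coniveau-k2-tangent-threefolds`: `KernelClassesExtendThreefolds` ((Surj) for d ≤ 3 from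
  the typed torsion-freeness of H^b(O), H^b(Ω¹) alone).
* Card C `isogeny-eigenweight-splitting`: `eigenSplit` (the algebra of the lever) and
  `AbelianTowerSplitting` ((Surj) ∧ (Lift_int) on the Ω¹-free branch = abelian schemes).
-/

noncomputable section

open CategoryTheory AlgebraicGeometry
open Literature.AlgebraicGeometry.Motives Literature.AlgebraicGeometry.KTheory
open Literature.AlgebraicGeometry.Motives.WittScheme Literature.AlgebraicGeometry.Crystalline

namespace Summit.HodgeConjecture.HodgeConjecture.Cruxes.FormalLiftingFromClassLifting.Sketch

section Predicates

variable {p : ℕ} [Fact p.Prime] {k : Type} [Field k] [CharP k p]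

/-- Hypothesis (⋆) CLASS-LIFTS-IMPLY-OBJECT-LIFTS of the crux, verbatim (one step, level-wise,
for finite locally free lifts `F` of `E₁` to `X_{n+1}`). -/
def ClassLiftsImplyObjectLifts (𝒳 : SchemeOver (WittVector p k))
    (E₁ : (specialFibre 𝒳).left.Modules) : Prop :=
  ∀ (n : ℕ) (F : (thickening 𝒳 (n + 1)).left.Modules) (hF : IsFiniteLocallyFree F),
    Nonempty ((Scheme.Modules.pullback (specialFibreToThickening 𝒳 n)).obj F ≅ E₁) →
    (∃ y : KZero (thickening 𝒳 (n + 2)).left,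
        KZero.map (thickeningMap 𝒳 (Nat.le_succ (n + 1))) y = KZero.of F hF) →
    ∃ F' : (thickening 𝒳 (n + 2)).left.Modules, IsFiniteLocallyFree F' ∧
      Nonempty ((Scheme.Modules.pullback (thickeningMap 𝒳 (Nat.le_succ (n + 1)))).obj F' ≅ F)

/-- An INTEGRAL compatible family of `K₀`-classes on the `p`-adic tower, i.e. an element of
`lim_n K₀(X_{n+1})` (indexing as in `LiftsFormally`: `η n` lives on `X_{n+1} = 𝒳 ⊗ W/p^{n+1}`). -/
def IsProClass (𝒳 : SchemeOver (WittVector p k))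
    (η : ∀ n : ℕ, KZero (thickening 𝒳 (n + 1)).left) : Prop :=
  ∀ n : ℕ, KZero.map (thickeningMap 𝒳 (Nat.le_succ (n + 1))) (η (n + 1)) = η n

/-- **(Lift_int)**: `[E₁] ∈ K₀(X_k)` is the foot of an INTEGRAL pro-class of the tower. -/
def IntegralProLift (𝒳 : SchemeOver (WittVector p k)) (E₁ : (specialFibre 𝒳).left.Modules)
    (hE₁ : IsFiniteLocallyFree E₁) : Prop :=
  ∃ η : ∀ n : ℕ, KZero (thickening 𝒳 (n + 1)).left, IsProClass 𝒳 η ∧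
    KZero.map (specialFibreToThickening 𝒳 0) (η 0) = KZero.of E₁ hE₁

/-- **(Surj)**: every `K₀`-class on a finite thickening `X_{m+1}` that DIES on the special fibre
extends to an integral pro-class of the whole tower ("kernel classes extend"). In weight one this
is `H¹(X_{m+1}, O) → H¹(X_m, O)` surjective for all `m`, i.e. exactly `H²(𝒳, O)[p] = 0`. -/
def KernelClassesExtend (𝒳 : SchemeOver (WittVector p k)) : Prop :=
  ∀ (m : ℕ) (y : KZero (thickening 𝒳 (m + 1)).left),
    KZero.map (specialFibreToThickening 𝒳 m) y = 0 →
    ∃ ε : ∀ n : ℕ, KZero (thickening 𝒳 (n + 1)).left, IsProClass 𝒳 ε ∧ ε m = y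

end Predicates

/-! ## Card A — `pro-class-correction-syntomic` -/

/-- **First lemma of card A (the TRANSFER; pure bookkeeping, no hypothesis on `𝒳`).**
Given (⋆), an integral pro-class under `[E₁]`, the extension property (Surj) and a lift of `E₁`
to `X_1` (classically automatic: `X_k ≅ X_1` for perfect `k`), `E₁` lifts formally. Proof on
paper: induct on `n` carrying `(F_n, η⁽ⁿ⁾)` with `η⁽ⁿ⁾ n = [F_n]`; (⋆) with `y = η⁽ⁿ⁾ (n+1)` gives
`F_{n+1}`; `δ = [F_{n+1}] - η⁽ⁿ⁾ (n+1)` dies on `X_{n+1}` hence on `X_k`; (Surj) gives a pro-class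
`ε` with `ε (n+1) = δ`; put `η⁽ⁿ⁺¹⁾ = η⁽ⁿ⁾ + ε`. CORRECT THE PRO-CLASS, NOT THE OBJECT. -/
def TransferA : Prop :=
  ∀ (p : ℕ) [Fact p.Prime] (k : Type) [Field k] [CharP k p]
    (𝒳 : SchemeOver (WittVector p k))
    (E₁ : (specialFibre 𝒳).left.Modules) (hE₁ : IsFiniteLocallyFree E₁),
    ClassLiftsImplyObjectLifts 𝒳 E₁ →
    IntegralProLift 𝒳 E₁ hE₁ →
    KernelClassesExtend 𝒳 →
    (∃ F₀ : (thickening 𝒳 1).left.Modules, IsFiniteLocallyFree F₀ ∧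
      Nonempty ((Scheme.Modules.pullback (specialFibreToThickening 𝒳 0)).obj F₀ ≅ E₁)) →
    LiftsFormally 𝒳 E₁

/-- **Second statement of card A ((Lift_int) from the crux's rational hypothesis).** Under
torsion-free Hodge cohomology (typed exactly as in the crux) the RATIONAL Bloch–Esnault–Kerz
pro-lift of `[E₁] ⊗ 1` (conclusion (b) of BEK Thm 1.3, the crux's last hypothesis) upgrades to an
INTEGRAL pro-class under `[E₁]`. Paper mechanism: clear denominators (`M·ξ = η ⊗ 1`,
`η|X_k = MN[E₁] + t`, `t` torsion), so the continuous obstruction of `[E₁]` is torsion; it lives in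
`π₋₁ K^cts(𝒳, X_k)`, whose graded pieces are `H^{2r}(𝒳, p(r)Ω^{<r})` INTEGRALLY (BEK Claim 49 /
DGM + BMS2 + AMMN Thm F(2)), torsion-free under the hypotheses — so it vanishes. -/
def IntegralProLiftOfRational : Prop :=
  ∀ (p : ℕ) [Fact p.Prime] (k : Type) [Field k] [CharP k p] [PerfectRing k p] (d : ℕ)
    (𝒳 : SchemeOver (WittVector p k)),
    IsSmoothProperModel d 𝒳 → IsProjectiveOverRing 𝒳 → d + 6 < p →
    (∀ (b : ℕ) (x : structureSheafCohomology 𝒳.left b), (p : ℤ) • x = 0 → x = 0) →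
    (∀ (b : ℕ) (x : hodgeCohomologyOne 𝒳 b), (p : ℤ) • x = 0 → x = 0) →
    (d ≤ 3 ∨ Nonempty (cotangentSheaf 𝒳 ≅
        SheafOfModules.free (R := 𝒳.left.ringCatSheaf) (Fin d))) →
    ∀ (E₁ : (specialFibre 𝒳).left.Modules) (hE₁ : IsFiniteLocallyFree E₁),
    (∃ ξ : ContinuousKZeroRat (Ideal.span {(p : WittVector p k)}) 𝒳,
        KZeroRat.map (specialFibreToTower 𝒳)
          (ContinuousKZeroRat.specialFibre (Ideal.span {(p : WittVector p k)}) 𝒳 ξ) =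
        KZeroRat.of E₁ hE₁) →
    IntegralProLift 𝒳 E₁ hE₁

/-! ## Card B — `coniveau-k2-tangent-threefolds` -/

/-- **First lemma of card B ((Surj) for threefolds from the TYPED hypotheses alone).** For
`d ≤ 3` the only obstructing weights are 1 and 2; by coniveau the weight-3 (point-supported) part
of `ker(K₀(X_{m+1}) → K₀(X_k))` extends for free (thickened points lift by Hensel), weight 1 is
`1 + pO ≅ pO` (log) governed by `H²(𝒳,O)[p] = 0`, and weight 2 is the relative `K₂`-sheaf
`K₂(O_{X_{m+1}}, pO) ≅ pΩ¹_{X_{m+1}}/p² dO` (Bloch–van der Kallen–Stienstra tangent calculus,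
p-adic form), governed by `H³(𝒳, Ω¹)[p] = 0`. No `Ω²`, `Ω³`, no duality. -/
def KernelClassesExtendThreefolds : Prop :=
  ∀ (p : ℕ) [Fact p.Prime] (k : Type) [Field k] [CharP k p] [PerfectRing k p] (d : ℕ)
    (𝒳 : SchemeOver (WittVector p k)),
    IsSmoothProperModel d 𝒳 → IsProjectiveOverRing 𝒳 → d ≤ 3 → d + 6 < p →
    (∀ (b : ℕ) (x : structureSheafCohomology 𝒳.left b), (p : ℤ) • x = 0 → x = 0) →
    (∀ (b : ℕ) (x : hodgeCohomologyOne 𝒳 b), (p : ℤ) • x = 0 → x = 0) →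
    KernelClassesExtend 𝒳

/-! ## Card C — `isogeny-eigenweight-splitting` -/

/-- **The algebra of the lever (card C).** An endomorphism `u` of a module with a two-step
filtration `S ≤ M` acting by the scalar `a` on `S` and by `b` modulo `S`, with `a - b` a unit,
splits the filtration canonically: `M = S ⊕ ker(u - b)`. Iterated over the (finite) syntomic weight
filtration of `π_* K(A_{m+1}, A_k)` with `u = [N]^*` (`N` a primitive root mod `p`, eigenvalue
`N^w` on weight `w`, `w ≤ 2d + 1 < p - 1`), it kills every extension and every differential. -/
def eigenSplit : Prop :=
  ∀ (R M : Type) [CommRing R] [AddCommGroup M] [Module R M] (u : M →ₗ[R] M)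
    (S : Submodule R M) (a b : R), IsUnit (a - b) →
    (∀ x ∈ S, u x = a • x) → (∀ x : M, u x - b • x ∈ S) →
    IsCompl S (LinearMap.ker (u - b • LinearMap.id))


/-- `eigenSplit` HOLDS (kernel-checked): the two-step splitting lemma of card C. -/
theorem eigenSplit_holds : eigenSplit := by
  intro R M _ _ _ u S a b hab hS hq
  obtain ⟨c, hc⟩ := hab.exists_left_inv
  have key : ∀ x : M, ((u - b • LinearMap.id : M →ₗ[R] M)) x = u x - b • x := fun x => by simp
  constructor
  · rw [Submodule.disjoint_def]
    intro x hxS hxT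
    rw [LinearMap.mem_ker, key] at hxT
    have h1 : (a - b) • x = 0 := by rw [sub_smul, ← hS x hxS]; exact hxT
    calc x = (c * (a - b)) • x := by rw [hc, one_smul]
      _ = c • ((a - b) • x) := mul_smul c (a - b) x
      _ = 0 := by rw [h1, smul_zero]
  · rw [codisjoint_iff, Submodule.eq_top_iff']
    intro x
    have hyS : u x - b • x ∈ S := hq x
    have e1 : u (u x - b • x) = a • (u x - b • x) := hS _ hyS
    have hmem : x - c • (u x - b • x) ∈ LinearMap.ker (u - b • LinearMap.id) := by
      rw [LinearMap.mem_ker, key]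
      have e2 : u (x - c • (u x - b • x)) - b • (x - c • (u x - b • x)) =
          (u x - b • x) - c • (u (u x - b • x) - b • (u x - b • x)) := by
        simp only [map_sub, map_smul]
        module
      rw [e2, e1, ← sub_smul, ← mul_smul, hc, one_smul, sub_self]
    exact Submodule.mem_sup.mpr ⟨c • (u x - b • x), S.smul_mem c hyS, x - c • (u x - b • x), hmem,
      by abel⟩

/-- **First lemma of card C (the Ω¹-free branch = abelian schemes).** On a smooth projective
`𝒳/W` with FREE cotangent sheaf and a `W`-section (then `𝒳` is an abelian scheme: the generic
fibre has trivial tangent bundle, hence is an abelian variety, and `𝒳` is its Néron model), the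
pull-backs `[N]^*` (`p ∤ N`) split all the relative `K`-groups of the tower into pure weights, on
which transition maps are reductions of FREE `W`-modules `Λ^• H¹(O) ⊗ Λ^• H⁰(Ω¹)`: hence (Surj), and
(Lift_int) from the rational hypothesis. Bound: `2 * d + 2 < p` (weights `≤ 2d+1` must have
distinct eigenvalues mod `p`); at the route's anchors (`d = 4`, `p ≥ 11`) this holds. -/
def AbelianTowerSplitting : Prop :=
  ∀ (p : ℕ) [Fact p.Prime] (k : Type) [Field k] [CharP k p] [PerfectRing k p] (d : ℕ)
    (𝒳 : SchemeOver (WittVector p k)),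
    IsSmoothProperModel d 𝒳 → IsProjectiveOverRing 𝒳 → 2 * d + 2 < p →
    Nonempty (cotangentSheaf 𝒳 ≅ SheafOfModules.free (R := 𝒳.left.ringCatSheaf) (Fin d)) →
    Nonempty (Spec (CommRingCat.of (WittVector p k)) ⟶ 𝒳.left) →
    KernelClassesExtend 𝒳 ∧
    ∀ (E₁ : (specialFibre 𝒳).left.Modules) (hE₁ : IsFiniteLocallyFree E₁),
      (∃ ξ : ContinuousKZeroRat (Ideal.span {(p : WittVector p k)}) 𝒳,
          KZeroRat.map (specialFibreToTower 𝒳)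
            (ContinuousKZeroRat.specialFibre (Ideal.span {(p : WittVector p k)}) 𝒳 ξ) =
          KZeroRat.of E₁ hE₁) →
      IntegralProLift 𝒳 E₁ hE₁

/-! ## Sanity: the three cards compose to the crux (shape check, proved). -/

/-- (⋆) as filed in the crux is literally `ClassLiftsImplyObjectLifts`. -/
example {p : ℕ} [Fact p.Prime] {k : Type} [Field k] [CharP k p]
    (𝒳 : SchemeOver (WittVector p k)) (E₁ : (specialFibre 𝒳).left.Modules) :
    ClassLiftsImplyObjectLifts 𝒳 E₁ ↔
    (∀ (n : ℕ) (F : (thickening 𝒳 (n + 1)).left.Modules) (hF : IsFiniteLocallyFree F),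
      Nonempty ((Scheme.Modules.pullback (specialFibreToThickening 𝒳 n)).obj F ≅ E₁) →
      (∃ y : KZero (thickening 𝒳 (n + 2)).left,
          KZero.map (thickeningMap 𝒳 (Nat.le_succ (n + 1))) y = KZero.of F hF) →
      ∃ F' : (thickening 𝒳 (n + 2)).left.Modules, IsFiniteLocallyFree F' ∧
        Nonempty ((Scheme.Modules.pullback (thickeningMap 𝒳 (Nat.le_succ (n + 1)))).obj F' ≅ F)) :=
  Iff.rfl

/-- Shape check: `TransferA ∧ IntegralProLiftOfRational ∧ (Surj on the hypotheses of the crux)`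
gives the crux body, modulo the classically-free lift of `E₁` to `X_1` (`X_k ≅ X_1`). -/
def CruxFromCards : Prop :=
  TransferA → IntegralProLiftOfRational →
  (∀ (p : ℕ) [Fact p.Prime] (k : Type) [Field k] [CharP k p] [PerfectRing k p] (d : ℕ)
    (𝒳 : SchemeOver (WittVector p k)),
    IsSmoothProperModel d 𝒳 → IsProjectiveOverRing 𝒳 → d + 6 < p →
    (∀ (b : ℕ) (x : structureSheafCohomology 𝒳.left b), (p : ℤ) • x = 0 → x = 0) →
    (∀ (b : ℕ) (x : hodgeCohomologyOne 𝒳 b), (p : ℤ) • x = 0 → x = 0) →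
    (d ≤ 3 ∨ Nonempty (cotangentSheaf 𝒳 ≅
        SheafOfModules.free (R := 𝒳.left.ringCatSheaf) (Fin d))) →
    KernelClassesExtend 𝒳) →
  ∀ (p : ℕ) [Fact p.Prime] (k : Type) [Field k] [CharP k p] [PerfectRing k p] (d : ℕ)
    (𝒳 : SchemeOver (WittVector p k)),
    IsSmoothProperModel d 𝒳 → IsProjectiveOverRing 𝒳 → d + 6 < p →
    (∀ (b : ℕ) (x : structureSheafCohomology 𝒳.left b), (p : ℤ) • x = 0 → x = 0) →
    (∀ (b : ℕ) (x : hodgeCohomologyOne 𝒳 b), (p : ℤ) • x = 0 → x = 0) →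
    (d ≤ 3 ∨ Nonempty (cotangentSheaf 𝒳 ≅
        SheafOfModules.free (R := 𝒳.left.ringCatSheaf) (Fin d))) →
    ∀ (E₁ : (specialFibre 𝒳).left.Modules) (hE₁ : IsFiniteLocallyFree E₁),
    ClassLiftsImplyObjectLifts 𝒳 E₁ →
    (∃ ξ : ContinuousKZeroRat (Ideal.span {(p : WittVector p k)}) 𝒳,
        KZeroRat.map (specialFibreToTower 𝒳)
          (ContinuousKZeroRat.specialFibre (Ideal.span {(p : WittVector p k)}) 𝒳 ξ) =
        KZeroRat.of E₁ hE₁) →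
    (∃ F₀ : (thickening 𝒳 1).left.Modules, IsFiniteLocallyFree F₀ ∧
      Nonempty ((Scheme.Modules.pullback (specialFibreToThickening 𝒳 0)).obj F₀ ≅ E₁)) →
    LiftsFormally 𝒳 E₁

/-- The composition is literally modus ponens. -/
theorem cruxFromCards : CruxFromCards := by
  intro hA hLift hSurj p _ k _ _ _ d 𝒳 h𝒳 hproj hp hO hΩ hd E₁ hE₁ hstar hξ hF₀
  exact hA p k 𝒳 E₁ hE₁ hstar (hLift p k d 𝒳 h𝒳 hproj hp hO hΩ hd E₁ hE₁ hξ)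
    (hSurj p k d 𝒳 h𝒳 hproj hp hO hΩ hd) hF₀

end Summit.HodgeConjecture.HodgeConjecture.Cruxes.FormalLiftingFromClassLifting.Sketch

end
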